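import Summits.Ventures.PercRepro.RankLevelSetCrossStep
import Summits.Ventures.PercRepro.RankLevelSetContractMono

/-!
# PercRepro — the same-cell deletion increment of the slack, and (MD′) at UNEXPOSED elements (night-1, gen 11)

For a non-loop `e` of a finite matroid `M` of rank `p + 1`, the EXACT identities (6.1)/(6.2) of
`RankLevelSetCrossStep` read, in slack form (`σ_N(P, Q) = #Y_N(P, Q) − Φ(P, Q)·#U_N(P, Q)`):

`σ_M(p+1, q+1) − σ_{M ＼ e}(p+1, q+1) = σ_{M ／ e}(p, q) + (Φ(p, q) − Φ(p+1, q+1))·#U_{M ／ e}(p, q)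
  + Φ(p+1, q+1)·(n⁰⁰_{p,q}(e) − n⁰⁰_{p,q+1}(e))`   (`slack_sub_delete_eq`),

`n⁰⁰_{a,b}(e) = freeCount M e a b` the `e`-free partitions of `E ∖ e` with ranks `(a, b)` (the two `n⁰⁰_{p+1,·}`
vanish because a side of full rank spans `e`).  With `Φ(p+1, q+1) ≤ Φ(p, q)` (`phiK_succ_succ_le`, termwise
`C(n+2, u+1)/C(n+2, p+1) ≤ C(n, u)/C(n, p)` for `q ≤ u ≤ p`, i.e. `(u+1)(n+1−u) ≥ (p+1)(q+1)`):

**(MD′) AT AN UNEXPOSED ELEMENT** (`slack_delete_le_of_unexposed`): if `e` admits no `e`-free partition of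
`E ∖ e` into a rank-`p` side and a rank-`(q+1)` side (`n⁰⁰_{p,q+1}(e) = 0`; in particular if `e` is a coloop of no
cocircuit of rank `≤ q + 2`), then `σ_{M ＼ e}(p+1, q+1) ≤ σ_M(p+1, q+1)` follows from C-025 for the contraction
at `(p, q)` — the hypothesis of `c025_of_deleteMonoExistsCore` (RankLevelSetDeleteMono) is therefore needed only
on cores in which EVERY element is exposed (`n⁰⁰_{p,q+1}(e) > 0` for all `e`).  Axioms: standard.
-/

open scoped Matroid

namespace PercRepro

namespace Matroid

open Set Finset

variable {α : Type} {M : _root_.Matroid α} {e : α}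

/-- `Φ(p+1, q+1) ≤ Φ(p, q)`: termwise `C(n+2, u+1)/C(n+2, p+1) ≤ C(n, u)/C(n, p)`
(`n = p + q`, `q < u < p`), since `C(n+2, u+1)·(u+1)·(n+1−u) = (n+2)(n+1)·C(n, u)` and
`(u+1)(n+1−u) ≥ (p+1)(q+1)` on `q ≤ u ≤ p`. -/
lemma phiK_succ_succ_le (p q : ℕ) : phiK (p + 1) (q + 1) ≤ phiK p q := by
  unfold phiK
  have hpos : (0 : ℚ) < ((p + q).choose p : ℚ) := by exact_mod_cast Nat.choose_pos (by omega)
  have hpos' : (0 : ℚ) < ((p + 1 + (q + 1)).choose (p + 1) : ℚ) := by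
    exact_mod_cast Nat.choose_pos (by omega)
  rw [div_le_div_iff₀ hpos' hpos, Finset.sum_mul, Finset.sum_mul]
  -- reindex the left sum `u ↦ u + 1`
  have hre : ∑ u ∈ Finset.Ioo (q + 1) (p + 1), ((p + 1 + (q + 1)).choose u : ℚ) * ((p + q).choose p : ℚ) =
      ∑ u ∈ Finset.Ioo q p, ((p + 1 + (q + 1)).choose (u + 1) : ℚ) * ((p + q).choose p : ℚ) := by
    rw [← Finset.map_add_right_Ioo q p 1, Finset.sum_map]
    rfl
  rw [hre]
  refine Finset.sum_le_sum (fun u hu => ?_)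
  rw [Finset.mem_Ioo] at hu
  have hn : p + 1 + (q + 1) = p + q + 2 := by ring
  rw [hn]
  -- (A) C(n+2, u+1)·(u+1) = (n+2)·C(n+1, u);  (B) C(n+1, u)·(n+1−u) = C(n, u)·(n+1)
  have hA : ((p + q + 2).choose (u + 1) : ℚ) * (u + 1) = (p + q + 2) * ((p + q + 1).choose u : ℚ) := by
    have h := Nat.add_one_mul_choose_eq (p + q + 1) u
    have h' : (p + q + 2) * (p + q + 1).choose u = (p + q + 2).choose (u + 1) * (u + 1) := h
    exact_mod_cast h'.symm
  have hB : ((p + q + 1).choose u : ℚ) * (p + q + 1 - u) = ((p + q).choose u : ℚ) * (p + q + 1) := by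
    have h3 := (Nat.choose_mul_succ_eq (p + q) u).symm
    have h4 : (p + q + 1 - u : ℚ) = ((p + q + 1 - u : ℕ) : ℚ) := by
      rw [Nat.cast_sub (by omega)]
      push_cast
      ring
    rw [h4]
    exact_mod_cast h3
  have hA' : ((p + q + 2).choose (p + 1) : ℚ) * (p + 1) = (p + q + 2) * ((p + q + 1).choose p : ℚ) := by
    have h := Nat.add_one_mul_choose_eq (p + q + 1) p
    have h' : (p + q + 2) * (p + q + 1).choose p = (p + q + 2).choose (p + 1) * (p + 1) := h
    exact_mod_cast h'.symm
  have hB' : ((p + q + 1).choose p : ℚ) * (q + 1) = ((p + q).choose p : ℚ) * (p + q + 1) := by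
    have h3 := (Nat.choose_mul_succ_eq (p + q) p).symm
    have h4 : ((p + q + 1 - p : ℕ) : ℚ) = (q + 1 : ℚ) := by
      rw [show p + q + 1 - p = q + 1 by omega]
      push_cast
      ring
    rw [← h4]
    exact_mod_cast h3
  -- the key: (p+1)(q+1) ≤ (u+1)(n+1−u)
  have hkey : ((p : ℚ) + 1) * (q + 1) ≤ ((u : ℚ) + 1) * (p + q + 1 - u) := by
    have hu1 : (q : ℚ) ≤ u := by exact_mod_cast hu.1.le
    have hu2 : (u : ℚ) ≤ p := by exact_mod_cast hu.2.le
    nlinarith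
  have hu3 : (0 : ℚ) < (p + q + 1 - u : ℚ) := by
    have : (u : ℚ) < p + q + 1 := by exact_mod_cast (by omega : u < p + q + 1)
    linarith
  have hnn : (0 : ℚ) ≤ ((p + q).choose u : ℚ) * ((p + q).choose p : ℚ) * ((p + q + 2) * (p + q + 1)) := by
    positivity
  -- multiply the target by the positive (u+1)(n+1−u)(p+1)(q+1)
  have key : ((p + q + 2).choose (u + 1) : ℚ) * ((p + q).choose p : ℚ) *
        (((u : ℚ) + 1) * (p + q + 1 - u) * ((p + 1) * (q + 1))) ≤
      ((p + q).choose u : ℚ) * ((p + q + 2).choose (p + 1) : ℚ) *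
        (((u : ℚ) + 1) * (p + q + 1 - u) * ((p + 1) * (q + 1))) := by
    have e1 : ((p + q + 2).choose (u + 1) : ℚ) * ((p + q).choose p : ℚ) *
        (((u : ℚ) + 1) * (p + q + 1 - u) * ((p + 1) * (q + 1))) =
        ((p + q).choose u : ℚ) * ((p + q).choose p : ℚ) * ((p + q + 2) * (p + q + 1)) *
          (((p : ℚ) + 1) * (q + 1)) := by
      linear_combination (((p + q).choose p : ℚ) * (((p : ℚ) + 1) * (q + 1)) * (p + q + 1 - u)) * hA
        + (((p + q).choose p : ℚ) * (((p : ℚ) + 1) * (q + 1)) * (p + q + 2)) * hB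
    have e2 : ((p + q).choose u : ℚ) * ((p + q + 2).choose (p + 1) : ℚ) *
        (((u : ℚ) + 1) * (p + q + 1 - u) * ((p + 1) * (q + 1))) =
        ((p + q).choose u : ℚ) * ((p + q).choose p : ℚ) * ((p + q + 2) * (p + q + 1)) *
          (((u : ℚ) + 1) * (p + q + 1 - u)) := by
      linear_combination (((p + q).choose u : ℚ) * (((u : ℚ) + 1) * (p + q + 1 - u)) * (q + 1)) * hA'
        + (((p + q).choose u : ℚ) * (((u : ℚ) + 1) * (p + q + 1 - u)) * (p + q + 2)) * hB'
    rw [e1, e2]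
    exact mul_le_mul_of_nonneg_left hkey hnn
  exact le_of_mul_le_mul_right key (by positivity)

section Finite

variable [M.Finite]

/-- **THE SAME-CELL DELETION INCREMENT OF THE SLACK** (exact; `r(M) = p + 1`, `e` a non-loop):
`σ_M(p+1, q+1) − σ_{M ＼ e}(p+1, q+1) = σ_{M ／ e}(p, q) + (Φ(p, q) − Φ(p+1, q+1))·#U_{M ／ e}(p, q)
+ Φ(p+1, q+1)·(n⁰⁰_{p,q}(e) − n⁰⁰_{p,q+1}(e))` — (6.1)/(6.2) of `RankLevelSetCrossStep` in slack form. -/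
theorem slack_sub_delete_eq (he : M.Indep {e}) {p : ℕ} (hR : M.eRank = ((p + 1 : ℕ) : ℕ∞)) (q : ℕ) :
    slack M (p + 1) (q + 1) - slack (M ＼ {e}) (p + 1) (q + 1) =
      slack (M ／ {e}) p q + (phiK p q - phiK (p + 1) (q + 1)) * (topCount (M ／ {e}) p q : ℚ) +
        phiK (p + 1) (q + 1) * ((freeCount M e p q : ℚ) - (freeCount M e p (q + 1) : ℚ)) := by
  have heE : e ∈ M.E := he.subset_ground (mem_singleton e)
  have hU := topCount_delete_contract_identity he p q
  have hY := midCount_delete_contract_identity he p q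
  rw [freeCount_eq_zero_of_eRank heE hR (q + 1), freeCount_eq_zero_of_eRank heE hR q] at hU
  have hU' : (topCount M (p + 1) (q + 1) : ℚ) + (freeCount M e p q : ℚ) =
      (topCount (M ＼ {e}) (p + 1) (q + 1) : ℚ) + (topCount (M ／ {e}) p q : ℚ) +
        (freeCount M e p (q + 1) : ℚ) := by
    have : topCount M (p + 1) (q + 1) + freeCount M e p q =
        topCount (M ＼ {e}) (p + 1) (q + 1) + topCount (M ／ {e}) p q + freeCount M e p (q + 1) := by
      omega
    exact_mod_cast this
  have hY' : (midCount M (p + 1) (q + 1) : ℚ) =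
      (midCount (M ＼ {e}) (p + 1) (q + 1) : ℚ) + (midCount (M ／ {e}) p q : ℚ) := by
    exact_mod_cast hY
  unfold slack
  linear_combination hY' - phiK (p + 1) (q + 1) * hU'

/-- **(MD′) AT AN UNEXPOSED ELEMENT**: `r(M) = p + 1`, `e` a non-loop with no `e`-free partition of `E ∖ e` of
ranks `(p, q+1)` (`n⁰⁰_{p,q+1}(e) = 0`), and `0 ≤ σ_{M ／ e}(p, q)` (C-025 for the contraction at `(p, q)`): then
the slack of the cell `(p+1, q+1)` is deletion-monotone at `e`, `σ_{M ＼ e}(p+1, q+1) ≤ σ_M(p+1, q+1)`. -/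
theorem slack_delete_le_of_unexposed (he : M.Indep {e}) {p q : ℕ} (hR : M.eRank = ((p + 1 : ℕ) : ℕ∞))
    (hfree : freeCount M e p (q + 1) = 0) (hIH : 0 ≤ slack (M ／ {e}) p q) :
    slack (M ＼ {e}) (p + 1) (q + 1) ≤ slack M (p + 1) (q + 1) := by
  have h := slack_sub_delete_eq he hR q
  rw [hfree] at h
  have hphi := phiK_succ_succ_le p q
  have hphi0 : 0 ≤ phiK (p + 1) (q + 1) := by unfold phiK; positivity
  have hU0 : (0 : ℚ) ≤ (topCount (M ／ {e}) p q : ℚ) := by positivity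
  have hf0 : (0 : ℚ) ≤ (freeCount M e p q : ℚ) := by positivity
  push_cast at h
  nlinarith [mul_nonneg (sub_nonneg.2 hphi) hU0, mul_nonneg hphi0 hf0]

/-- The same, in the cell's `(p, q)` indexing with `q + 2 ≤ p` and `r(M) = p`. -/
theorem slack_delete_le_of_unexposed' (he : M.Indep {e}) {p q : ℕ} (hq : 1 ≤ q) (hpq : q + 2 ≤ p)
    (hR : M.eRank = (p : ℕ∞)) (hfree : freeCount M e (p - 1) q = 0)
    (hIH : 0 ≤ slack (M ／ {e}) (p - 1) (q - 1)) :
    slack (M ＼ {e}) p q ≤ slack M p q := by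
  obtain ⟨p', rfl⟩ : ∃ p', p = p' + 1 := ⟨p - 1, by omega⟩
  obtain ⟨q', rfl⟩ : ∃ q', q = q' + 1 := ⟨q - 1, by omega⟩
  simp only [Nat.add_sub_cancel] at hfree hIH
  exact slack_delete_le_of_unexposed he hR hfree hIH

end Finite

end Matroid

end PercRepro
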